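import Mathlib
import Literature.Geometry.Symplectic.McleanDivisorComplementConvexFour
import HarnessLib

/-!
# The complement of a compact submanifold of codimension at least two is connected

Topic `Literature/Geometry/Symplectic` (discharge of the named fact
`Literature.Geometry.Symplectic.isConnected_compl_range_of_isSmoothEmbedding` of
`McleanDivisorComplementConvexFour.lean`; A. Kosinski, *Differential Manifolds* (1993), X.1,
proof of Prop. (1.1)).  Everything here is PROVED.

**Statement.** `N` a connected `C^∞` `p`-manifold without boundary, `S` a compact `C^∞`
`m`-manifold, `b : S → N` a `C^∞` embedding (Mathlib's `Manifold.IsSmoothEmbedding`),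
`m + 2 ≤ p`.  Then `N ∖ b(S)` is connected (in particular nonempty).

**Proof** (general position, by Hausdorff dimension; only the smoothness of `b` and the
compactness of `S` are used, not injectivity).  Kosinski's route is homological
(`Hᵢ(M ∖ S) ≅ Hᵢ(M)` for `i < codim S - 1`); we follow instead the elementary transversality
argument "a generic broken line misses a set of dimension `≤ m + 1 < p`", in the form in which
Mathlib already has the particular case of Sard's theorem
(`dimH_image_le_of_locally_lipschitzOn`, `dense_compl_of_dimH_lt_finrank`; cf. Lee,
*Introduction to Smooth Manifolds* (2012), Cor. 6.11: the image of a smooth map from a manifold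
of smaller dimension is null).

* *Euclidean step* (`dimH_lineCone_image_le`, `isPreconnected_diff_of_dimH_lineCone_lt`,
  `dense_compl_of_dimH_lineCone_lt`).  For `T ⊆ E` and `x ∈ E` the *line cone*
  `{x + t (τ - x) | τ ∈ T, t ∈ ℝ}` of a `C¹` image `T = φ(A)`, `A ⊆ F` open, is a `C¹` image of
  `A × ℝ`, so it has Hausdorff dimension `≤ dim F + 1`.  If all line cones of `T` have dimension
  `< dim E`, then an open convex `C` minus `T` is preconnected: given `x, y ∈ C ∖ T`, the union
  of the two cones has dense complement, so some `z ∈ C` lies outside both, and then the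
  segments `[x, z]`, `[y, z]` lie in `C ∖ T` (a point of `T` on `[x, z]` would put `z` on the cone
  at `x`).
* *Chart step* (`dimH_lineCone_extChartAt_image_range_le`,
  `exists_mem_nhds_isPreconnected_inter_compl_range`,
  `dense_compl_range_of_contMDiff`).  Cover `S` by finitely many charts; in an extended chart
  `e` of `N` at `q`, `e(b(S) ∩ source e)` is a finite union of `C^∞` images of open subsets of
  `ℝᵐ` (`contMDiff_iff`), so its line cones have dimension `≤ m + 1 < p`.  Hence a coordinate
  ball around `q` minus `b(S)` is preconnected, and `b(S)` has dense complement.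
* *Local to global* (`isPreconnected_of_dense_of_forall_exists_nhds`).  A dense subset `A` of a
  preconnected space which is preconnected near every point is preconnected: for open `u, v`
  covering `A` and disjoint on `A`, the sets of points near which `A ⊆ u`, resp. `A ⊆ v`, are
  open, disjoint (density) and cover (local preconnectedness), so one of them is everything.

## References

* A. A. Kosinski, *Differential Manifolds*, Pure and Applied Mathematics 138, Academic Press
  (1993), X.1, Prop. 1.1 (and VI.9–10). [Kosinski1993]
* J. M. Lee, *Introduction to Smooth Manifolds*, 2nd ed., GTM 218, Springer (2012), Thm. 6.9,
  Cor. 6.11. [Lee2012]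
-/

noncomputable section

open scoped _root_.Manifold _root_.ContDiff _root_.Topology _root_.ENNReal
open _root_.Set _root_.Function _root_.Filter _root_.Module

namespace Literature.Geometry.Symplectic

section Euclidean

variable {E : Type*} [NormedAddCommGroup E] [NormedSpace ℝ E]

/-- **Line cones over `C¹` images are thin.** For `φ : F → E` of class `C¹` on an open set
`A` and any `x ∈ E`, the line cone `{x + t • (τ - x) | τ ∈ φ '' A, t ∈ ℝ}` has Hausdorff
dimension at most `dim F + 1` (it is a `C¹`, hence locally Lipschitz, image of `A × ℝ`).
[folklore] -/
theorem dimH_lineCone_image_le {F : Type*} [NormedAddCommGroup F] [NormedSpace ℝ F]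
    [FiniteDimensional ℝ F] {φ : F → E} {A : Set F} (hA : IsOpen A) (hφ : ContDiffOn ℝ 1 φ A)
    (x : E) :
    dimH ((fun q : E × ℝ => x + q.2 • (q.1 - x)) '' ((φ '' A) ×ˢ (univ : Set ℝ))) ≤
      (finrank ℝ F + 1 : ℕ) := by
  have hset : (fun q : E × ℝ => x + q.2 • (q.1 - x)) '' ((φ '' A) ×ˢ (univ : Set ℝ)) =
      (fun q : F × ℝ => x + q.2 • (φ q.1 - x)) '' (A ×ˢ (univ : Set ℝ)) := by
    ext z
    constructor
    · rintro ⟨⟨τ, t⟩, ⟨⟨a, ha, rfl⟩, -⟩, rfl⟩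
      exact ⟨(a, t), ⟨ha, trivial⟩, rfl⟩
    · rintro ⟨⟨a, t⟩, ⟨ha, -⟩, rfl⟩
      exact ⟨(φ a, t), ⟨⟨a, ha, rfl⟩, trivial⟩, rfl⟩
  rw [hset]
  have hG : ContDiffOn ℝ 1 (fun q : F × ℝ => x + q.2 • (φ q.1 - x)) (A ×ˢ (univ : Set ℝ)) := by
    refine contDiffOn_const.add (contDiffOn_snd.smul ?_)
    exact (hφ.comp contDiffOn_fst fun q hq => hq.1).sub contDiffOn_const
  have hopen : IsOpen (A ×ˢ (univ : Set ℝ)) := hA.prod isOpen_univ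
  calc dimH ((fun q : F × ℝ => x + q.2 • (φ q.1 - x)) '' (A ×ˢ (univ : Set ℝ)))
        ≤ dimH (A ×ˢ (univ : Set ℝ)) := by
        refine dimH_image_le_of_locally_lipschitzOn fun q hq => ?_
        obtain ⟨K, t, ht, hK⟩ :=
          ((hG q hq).contDiffAt (hopen.mem_nhds hq)).exists_lipschitzOnWith
        exact ⟨K, t, mem_nhdsWithin_of_mem_nhds ht, hK⟩
    _ ≤ dimH (univ : Set (F × ℝ)) := dimH_mono (subset_univ _)
    _ = finrank ℝ (F × ℝ) := Real.dimH_univ_eq_finrank _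
    _ = (finrank ℝ F + 1 : ℕ) := by rw [Module.finrank_prod, Module.finrank_self]

/-- **A set with thin line cones does not disconnect an open convex set.** If every line cone
`{x + t • (τ - x) | τ ∈ T, t ∈ ℝ}` of `T` has Hausdorff dimension `< dim E`, then `C ∖ T` is
preconnected for every open convex `C`: two points of `C ∖ T` are joined by the broken line
through a point of `C` outside both of their cones (which exists, the union of the two cones
having dense complement). [folklore] -/
theorem isPreconnected_diff_of_dimH_lineCone_lt [FiniteDimensional ℝ E] {C T : Set E}
    (hC : Convex ℝ C) (hCo : IsOpen C)
    (hT : ∀ x : E,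
      dimH ((fun q : E × ℝ => x + q.2 • (q.1 - x)) '' (T ×ˢ (univ : Set ℝ))) < finrank ℝ E) :
    IsPreconnected (C \ T) := by
  have key : ∀ x ∈ C \ T, ∀ z ∈ C,
      z ∉ (fun q : E × ℝ => x + q.2 • (q.1 - x)) '' (T ×ˢ (univ : Set ℝ)) →
      segment ℝ x z ⊆ C \ T := by
    rintro x ⟨hxC, hxT⟩ z hzC hz
    rw [segment_eq_image']
    rintro _ ⟨θ, ⟨hθ0, hθ1⟩, rfl⟩
    refine ⟨hC.add_smul_sub_mem hxC hzC ⟨hθ0, hθ1⟩, fun hT' => ?_⟩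
    rcases eq_or_lt_of_le hθ0 with rfl | hθpos
    · simp at hT'
      exact hxT hT'
    · refine hz ⟨(x + θ • (z - x), θ⁻¹), ⟨hT', trivial⟩, ?_⟩
      simp [smul_smul, inv_mul_cancel₀ hθpos.ne']
  apply isPreconnected_of_forall_pair
  intro x hx y hy
  have hd : Dense ((fun q : E × ℝ => x + q.2 • (q.1 - x)) '' (T ×ˢ (univ : Set ℝ)) ∪
      (fun q : E × ℝ => y + q.2 • (q.1 - y)) '' (T ×ˢ (univ : Set ℝ)))ᶜ := by
    apply dense_compl_of_dimH_lt_finrank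
    rw [dimH_union]
    exact max_lt (hT x) (hT y)
  obtain ⟨z, hzC, hz⟩ := hd.inter_open_nonempty C hCo ⟨x, hx.1⟩
  rw [mem_compl_iff, mem_union, not_or] at hz
  refine ⟨segment ℝ x z ∪ segment ℝ y z,
    union_subset (key x hx z hzC hz.1) (key y hy z hzC hz.2),
    Or.inl (left_mem_segment ℝ x z), Or.inr (left_mem_segment ℝ y z), ?_⟩
  exact IsPreconnected.union z (right_mem_segment ℝ x z) (right_mem_segment ℝ y z)
    (convex_segment x z).isPreconnected (convex_segment y z).isPreconnected

/-- **A set with a thin line cone has dense complement** (`T` lies on its own line cone at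
any `x`, at parameter `t = 1`). [folklore] -/
theorem dense_compl_of_dimH_lineCone_lt [FiniteDimensional ℝ E] {T : Set E} (x : E)
    (hT : dimH ((fun q : E × ℝ => x + q.2 • (q.1 - x)) '' (T ×ˢ (univ : Set ℝ))) < finrank ℝ E) :
    Dense Tᶜ := by
  refine dense_compl_of_dimH_lt_finrank (lt_of_le_of_lt (dimH_mono fun τ hτ => ?_) hT)
  exact ⟨(τ, 1), ⟨hτ, trivial⟩, by simp⟩

end Euclidean

section Chart

variable {m p : ℕ} {N : Type*} [TopologicalSpace N] [ChartedSpace (EuclideanSpace ℝ (Fin p)) N]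
  [IsManifold (𝓡 p) ∞ N]
  {S : Type*} [TopologicalSpace S] [CompactSpace S] [ChartedSpace (EuclideanSpace ℝ (Fin m)) S]
  [IsManifold (𝓡 m) ∞ S] {b : S → N}

/-- **Chart images of `b(S)` have thin line cones.** For a `C^∞` map `b` from a compact
`m`-manifold `S` and an extended chart `e` of `N` at `q`, every line cone of
`e '' (range b ∩ e.source)` has Hausdorff dimension at most `m + 1`: by compactness and
`contMDiff_iff` this set is a finite union of `C^∞` images of open subsets of `ℝᵐ`, and
`dimH_lineCone_image_le` applies to each. [folklore] -/
theorem dimH_lineCone_extChartAt_image_range_le (hb : ContMDiff (𝓡 m) (𝓡 p) ∞ b) (q : N)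
    (x : EuclideanSpace ℝ (Fin p)) :
    dimH ((fun w : EuclideanSpace ℝ (Fin p) × ℝ => x + w.2 • (w.1 - x)) ''
      ((extChartAt (𝓡 p) q '' (range b ∩ (extChartAt (𝓡 p) q).source)) ×ˢ (univ : Set ℝ))) ≤
      (m + 1 : ℕ) := by
  set e := extChartAt (𝓡 p) q
  obtain ⟨t, ht⟩ := CompactSpace.elim_nhds_subcover
    (fun s : S => (chartAt (EuclideanSpace ℝ (Fin m)) s).source)
    (fun s => (chartAt _ s).open_source.mem_nhds (mem_chart_source _ s))
  -- the chart pieces `φ s '' A s` covering `e '' (range b ∩ e.source)`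
  set A : S → Set (EuclideanSpace ℝ (Fin m)) := fun s =>
    (extChartAt (𝓡 m) s).target ∩ (extChartAt (𝓡 m) s).symm ⁻¹' (b ⁻¹' e.source)
  set φ : S → EuclideanSpace ℝ (Fin m) → EuclideanSpace ℝ (Fin p) := fun s =>
    e ∘ b ∘ (extChartAt (𝓡 m) s).symm
  have hcover : e '' (range b ∩ e.source) ⊆ ⋃ s ∈ (t : Set S), φ s '' A s := by
    rintro _ ⟨z, ⟨⟨y, rfl⟩, hz⟩, rfl⟩
    have hy : y ∈ ⋃ s ∈ t, (chartAt (EuclideanSpace ℝ (Fin m)) s).source := by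
      rw [ht]; trivial
    obtain ⟨s, hs, hys⟩ := mem_iUnion₂.1 hy
    have hys' : y ∈ (extChartAt (𝓡 m) s).source := by rwa [extChartAt_source]
    refine mem_iUnion₂.2 ⟨s, Finset.mem_coe.2 hs, ⟨extChartAt (𝓡 m) s y, ⟨?_, ?_⟩, ?_⟩⟩
    · exact (extChartAt (𝓡 m) s).map_source hys'
    · show b ((extChartAt (𝓡 m) s).symm (extChartAt (𝓡 m) s y)) ∈ e.source
      rw [(extChartAt (𝓡 m) s).left_inv hys']
      exact hz
    · show e (b ((extChartAt (𝓡 m) s).symm (extChartAt (𝓡 m) s y))) = e (b y)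
      rw [(extChartAt (𝓡 m) s).left_inv hys']
  have hpiece : ∀ s : S,
      dimH ((fun w : EuclideanSpace ℝ (Fin p) × ℝ => x + w.2 • (w.1 - x)) ''
        ((φ s '' A s) ×ˢ (univ : Set ℝ))) ≤ (m + 1 : ℕ) := by
    intro s
    have hAo : IsOpen (A s) :=
      (continuousOn_extChartAt_symm s).isOpen_inter_preimage (isOpen_extChartAt_target s)
        ((isOpen_extChartAt_source q).preimage hb.continuous)
    have hφs : ContDiffOn ℝ 1 (φ s) (A s) :=
      ((contMDiff_iff.1 hb).2 s q).of_le (by norm_num)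
    have := dimH_lineCone_image_le hAo hφs x
    simpa [finrank_euclideanSpace_fin] using this
  calc dimH ((fun w : EuclideanSpace ℝ (Fin p) × ℝ => x + w.2 • (w.1 - x)) ''
          ((e '' (range b ∩ e.source)) ×ˢ (univ : Set ℝ)))
        ≤ dimH ((fun w : EuclideanSpace ℝ (Fin p) × ℝ => x + w.2 • (w.1 - x)) ''
          ((⋃ s ∈ (t : Set S), φ s '' A s) ×ˢ (univ : Set ℝ))) :=
        dimH_mono (image_mono (prod_mono hcover Subset.rfl))
    _ = dimH (⋃ s ∈ (t : Set S), (fun w : EuclideanSpace ℝ (Fin p) × ℝ => x + w.2 • (w.1 - x)) ''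
          ((φ s '' A s) ×ˢ (univ : Set ℝ))) := by
        rw [iUnion₂_prod_const, image_iUnion₂]
    _ = ⨆ s ∈ (t : Set S), dimH ((fun w : EuclideanSpace ℝ (Fin p) × ℝ => x + w.2 • (w.1 - x)) ''
          ((φ s '' A s) ×ˢ (univ : Set ℝ))) := dimH_bUnion t.countable_toSet _
    _ ≤ (m + 1 : ℕ) := iSup₂_le fun s _ => hpiece s

/-- **Coordinate balls minus `b(S)` are preconnected.** If `m + 2 ≤ p` and `b : S → N` is
`C^∞` on a compact `m`-manifold, every point `q` of the `p`-manifold `N` has a neighbourhood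
`V` (the preimage of a small coordinate ball) with `V ∩ (range b)ᶜ` preconnected: in the chart
this is a ball minus a set with line cones of dimension `≤ m + 1 < p`
(`isPreconnected_diff_of_dimH_lineCone_lt`). [folklore] -/
theorem exists_mem_nhds_isPreconnected_inter_compl_range (hmp : m + 2 ≤ p)
    (hb : ContMDiff (𝓡 m) (𝓡 p) ∞ b) (q : N) :
    ∃ V ∈ 𝓝 q, IsPreconnected (V ∩ (range b)ᶜ) := by
  set e := extChartAt (𝓡 p) q
  obtain ⟨r, hr, hball⟩ : ∃ r > 0, Metric.ball (e q) r ⊆ e.target :=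
    Metric.isOpen_iff.1 (isOpen_extChartAt_target q) (e q) (mem_extChartAt_target q)
  set D := Metric.ball (e q) r
  set T := e '' (range b ∩ e.source)
  refine ⟨e.source ∩ e ⁻¹' D, ?_, ?_⟩
  · refine ((continuousOn_extChartAt q).isOpen_inter_preimage (isOpen_extChartAt_source q)
      Metric.isOpen_ball).mem_nhds ⟨mem_extChartAt_source q, ?_⟩
    exact Metric.mem_ball_self hr
  · have hpre : IsPreconnected (D \ T) :=
      isPreconnected_diff_of_dimH_lineCone_lt (convex_ball _ _) Metric.isOpen_ball fun x =>
        (dimH_lineCone_extChartAt_image_range_le hb q x).trans_lt (by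
          rw [finrank_euclideanSpace_fin]; exact_mod_cast (by omega : m + 1 < p))
    have heq : e.source ∩ e ⁻¹' D ∩ (range b)ᶜ = e.symm '' (D \ T) := by
      ext z
      constructor
      · rintro ⟨⟨hzs, hzD⟩, hzB⟩
        refine ⟨e z, ⟨hzD, ?_⟩, e.left_inv hzs⟩
        rintro ⟨w, ⟨hwB, hws⟩, hw⟩
        apply hzB
        have : w = z := by rw [← e.left_inv hws, ← e.left_inv hzs, hw]
        exact this ▸ hwB
      · rintro ⟨y, ⟨hyD, hyT⟩, rfl⟩
        have hyt : y ∈ e.target := hball hyD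
        refine ⟨⟨e.map_target hyt, ?_⟩, fun hB => hyT ⟨e.symm y, ⟨hB, e.map_target hyt⟩,
          e.right_inv hyt⟩⟩
        show e (e.symm y) ∈ D
        rw [e.right_inv hyt]
        exact hyD
    rw [heq]
    exact hpre.image _ ((continuousOn_extChartAt_symm q).mono (sdiff_subset.trans hball))

/-- **`b(S)` has dense complement** when `m + 2 ≤ p` (indeed whenever `m < p`): in a chart at
`q` the image of a neighbourhood is a neighbourhood, while the image of `b(S)` has dense
complement (`dense_compl_of_dimH_lineCone_lt`). [folklore] -/
theorem dense_compl_range_of_contMDiff (hmp : m + 2 ≤ p) (hb : ContMDiff (𝓡 m) (𝓡 p) ∞ b) :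
    Dense (range b)ᶜ := by
  rw [dense_iff_inter_open]
  rintro O hO ⟨q, hq⟩
  set e := extChartAt (𝓡 p) q
  have hTd : Dense (e '' (range b ∩ e.source))ᶜ :=
    dense_compl_of_dimH_lineCone_lt (e q)
      ((dimH_lineCone_extChartAt_image_range_le hb q (e q)).trans_lt (by
        rw [finrank_euclideanSpace_fin]; exact_mod_cast (by omega : m + 1 < p)))
  have hn : e '' (O ∩ e.source) ∈ 𝓝 (e q) :=
    extChartAt_image_nhds_mem_nhds_of_boundaryless
      ((hO.inter (isOpen_extChartAt_source q)).mem_nhds ⟨hq, mem_extChartAt_source q⟩)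
  obtain ⟨_, hzT, z, ⟨hzO, hzs⟩, rfl⟩ := hTd.inter_nhds_nonempty hn
  exact ⟨z, hzO, fun ⟨y, hy⟩ => hzT ⟨z, ⟨⟨y, hy⟩, hzs⟩, rfl⟩⟩

end Chart

section LocalToGlobal

variable {X : Type*} [TopologicalSpace X]

/-- **Local-to-global connectedness.** A dense subset `A` of a preconnected space which is
preconnected near every point of the space (every point has a neighbourhood `V` with `V ∩ A`
preconnected) is preconnected: for open `u, v` covering `A` and disjoint on `A`, the sets of
points near which `A ⊆ u`, resp. `A ⊆ v`, are open, disjoint by density, and cover by the local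
hypothesis; so one of them is the whole space, and then `A ⊆ u`, resp. `A ⊆ v` (density again).
[folklore] -/
theorem isPreconnected_of_dense_of_forall_exists_nhds [PreconnectedSpace X] {A : Set X}
    (hd : Dense A) (hl : ∀ q : X, ∃ V ∈ 𝓝 q, IsPreconnected (V ∩ A)) : IsPreconnected A := by
  rw [isPreconnected_iff_subset_of_disjoint]
  -- the final step, stated once for both orders of `u`, `v`
  have main : ∀ u v : Set X, IsOpen v → A ⊆ u ∪ v → A ∩ (u ∩ v) = ∅ →
      {q : X | ∀ᶠ z in 𝓝 q, z ∈ A → z ∈ u} = univ → A ⊆ u := by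
    intro u v hv huv hdisj hW z hzA
    by_contra hzu
    have hzv : z ∈ v := (huv hzA).resolve_left hzu
    have h1 : ∀ᶠ w in 𝓝 z, w ∈ A → w ∈ u := by
      have : z ∈ {q : X | ∀ᶠ z in 𝓝 q, z ∈ A → z ∈ u} := by rw [hW]; trivial
      exact this
    have h3 : ∀ᶠ w in 𝓝 z, w ∉ A := (h1.and (hv.mem_nhds hzv)).mono fun w hw hwA => by
      have : w ∈ A ∩ (u ∩ v) := ⟨hwA, hw.1 hwA, hw.2⟩
      rw [hdisj] at this
      exact this
    obtain ⟨w, hwA, hw⟩ := hd.inter_nhds_nonempty h3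
    exact hw hwA
  intro u v hu hv huv hdisj
  set Wu := {q : X | ∀ᶠ z in 𝓝 q, z ∈ A → z ∈ u}
  set Wv := {q : X | ∀ᶠ z in 𝓝 q, z ∈ A → z ∈ v}
  have hWuo : IsOpen Wu := isOpen_setOf_eventually_nhds
  have hWvo : IsOpen Wv := isOpen_setOf_eventually_nhds
  have hcover : Wu ∪ Wv = univ := by
    refine eq_univ_of_forall fun q => ?_
    obtain ⟨V, hV, hVA⟩ := hl q
    have hVd : V ∩ A ∩ (u ∩ v) = ∅ := by
      rw [← subset_empty_iff, ← hdisj]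
      exact inter_subset_inter_left _ inter_subset_right
    rcases (isPreconnected_iff_subset_of_disjoint.1 hVA) u v hu hv
      (inter_subset_right.trans huv) hVd with h | h
    · exact Or.inl (mem_of_superset hV fun z hzV hzA => h ⟨hzV, hzA⟩)
    · exact Or.inr (mem_of_superset hV fun z hzV hzA => h ⟨hzV, hzA⟩)
  have hdisjW : Wu ∩ Wv = ∅ := by
    refine eq_empty_of_forall_notMem fun q ⟨hqu, hqv⟩ => ?_
    have h3 : ∀ᶠ z in 𝓝 q, z ∉ A :=
      (Eventually.and hqu hqv).mono fun z hz hzA => by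
        have : z ∈ A ∩ (u ∩ v) := ⟨hzA, hz.1 hzA, hz.2 hzA⟩
        rw [hdisj] at this
        exact this
    obtain ⟨z, hzA, hz⟩ := hd.inter_nhds_nonempty h3
    exact hz hzA
  have hclopen : IsClopen Wu := by
    refine ⟨⟨?_⟩, hWuo⟩
    have : Wuᶜ = Wv := by
      refine Subset.antisymm (fun q hq => ?_) fun q hq hq' => ?_
      · have : q ∈ Wu ∪ Wv := by rw [hcover]; trivial
        exact this.resolve_left hq
      · have : q ∈ Wu ∩ Wv := ⟨hq', hq⟩
        rw [hdisjW] at this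
        exact this
    rw [this]
    exact hWvo
  rcases isClopen_iff.1 hclopen with h | h
  · right
    refine main v u hu (union_comm u v ▸ huv) (inter_comm u v ▸ hdisj) ?_
    rw [← hcover, h, empty_union]
  · exact Or.inl (main u v hv huv hdisj h)

end LocalToGlobal

/-- **Discharge of the named fact `isConnected_compl_range_of_isSmoothEmbedding`**
(Kosinski, *Differential Manifolds* (1993), X.1, Prop. 1.1): the complement of the image of a
`C^∞` embedding of a compact `m`-manifold into a connected `p`-manifold without boundary,
`m + 2 ≤ p`, is connected — nonempty because it is dense
(`dense_compl_range_of_contMDiff`), preconnected by the local-to-global lemma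
`isPreconnected_of_dense_of_forall_exists_nhds` fed with
`exists_mem_nhds_isPreconnected_inter_compl_range`.  Only `ContMDiff` of the embedding is
used. [cite: Kosinski1993, X.1, Prop. 1.1] -/
theorem isConnected_compl_range_of_isSmoothEmbedding_holds :
    isConnected_compl_range_of_isSmoothEmbedding := by
  intro m p N _ _ _ _ _ _ S _ _ _ _ b hmp hb
  have hb' : ContMDiff (𝓡 m) (𝓡 p) ∞ b := hb.contMDiff
  have hd : Dense (range b)ᶜ := dense_compl_range_of_contMDiff hmp hb'
  exact ⟨hd.nonempty, isPreconnected_of_dense_of_forall_exists_nhds hd fun q =>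
    exists_mem_nhds_isPreconnected_inter_compl_range hmp hb' q⟩

end Literature.Geometry.Symplectic
end
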